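import Summits.Ventures.PackingBounds.ThreePointCert.K11d12AggG1
import Summits.Ventures.PackingBounds.ThreePointCert.K11d12AggP

/-!
# κ(11) ≤ 873: kernel validation of Gram block R0 (chunks 6–10 of 11)

Framing: lottery ticket; floor = certified bounds/negative ranges. Venture `PackingBounds` (cell
`pub-packcert`), three-point SDP family, kissing column. Integer data / kernel checks of a feasible point of the
Bachoc–Vallentin semidefinite program (n = 11, s = 1/2, three-point matrix degree 12, two-point (Gegenbauer) part to
degree L = 24, Bachoc–Vallentin multiplier set = cell mode sym2; exact rational certificate `sdp-n11-d12-s1-2-sym2-a24-hyb7-j143229.json`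
(sha256 71f43c97292b2ed74c46266752e5818d2e2df39f63050a97ad023f586c9f7175) of the sdp seat's hybrid pipeline, verified by the cell's two exact verifiers), converted by
`cert2lean_g9.py` (lp gen 9; S = 66) into the units of the kernel checker `ThreePointCert.Check` + `CheckSym2` with the
record degree field set to L = 24 (the checker's degree enters only the unit `W = 2^d·d!` and the side conditions, so a
(d, L) certificate is a `Cert3` of degree L); Gram factors offset-encoded for the Kronecker-packed chunk validation
`ThreePointCert.CheckKron`; split check of (ii') `ThreePointCert.CheckSym2Split`. Emitter `emitlean_g9s.py` (lp gen 9: coarse Gram factors `L′ ≈ L/2^k`,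
expansions `4^k • zᵀ(L′L′ᵀ)z` lifted by `SoundNN.boxNonneg_smul`; layout of lp gen 8's K5d14 chain). Generated file: plain lists of integers / monomials.
-/

namespace Summit.Ventures.PackingBounds.ThreePointCert.K11d12

open Literature.Geometry.DiscreteGeometry Literature.Geometry.DiscreteGeometry.PolyCert PolyCert.SPoly

set_option maxRecDepth 100000 in
set_option maxHeartbeats 0 in
/-- Block `R0`: rows from 268 (38 rows) of `zᵀ(LLᵀ)z` added to `dR0c5` give `dR0c6` (kernel, Kronecker-packed chunk check). -/
theorem okR0_6 : chunkOKK K11d12.gR0K 268 38 K11d12.dR0c5 K11d12.dR0c6 = true := by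
  decide +kernel

set_option maxRecDepth 100000 in
set_option maxHeartbeats 0 in
/-- Block `R0`: rows from 306 (35 rows) of `zᵀ(LLᵀ)z` added to `dR0c6` give `dR0c7` (kernel, Kronecker-packed chunk check). -/
theorem okR0_7 : chunkOKK K11d12.gR0K 306 35 K11d12.dR0c6 K11d12.dR0c7 = true := by
  decide +kernel

set_option maxRecDepth 100000 in
set_option maxHeartbeats 0 in
/-- Block `R0`: rows from 341 (33 rows) of `zᵀ(LLᵀ)z` added to `dR0c7` give `dR0c8` (kernel, Kronecker-packed chunk check). -/
theorem okR0_8 : chunkOKK K11d12.gR0K 341 33 K11d12.dR0c7 K11d12.dR0c8 = true := by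
  decide +kernel

set_option maxRecDepth 100000 in
set_option maxHeartbeats 0 in
/-- Block `R0`: rows from 374 (31 rows) of `zᵀ(LLᵀ)z` added to `dR0c8` give `dR0c9` (kernel, Kronecker-packed chunk check). -/
theorem okR0_9 : chunkOKK K11d12.gR0K 374 31 K11d12.dR0c8 K11d12.dR0c9 = true := by
  decide +kernel

set_option maxRecDepth 100000 in
set_option maxHeartbeats 0 in
/-- Block `R0`: rows from 405 (30 rows) of `zᵀ(LLᵀ)z` added to `dR0c9` give `dR0c10` (kernel, Kronecker-packed chunk check). -/
theorem okR0_10 : chunkOKK K11d12.gR0K 405 30 K11d12.dR0c9 K11d12.dR0c10 = true := by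
  decide +kernel

end Summit.Ventures.PackingBounds.ThreePointCert.K11d12
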